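import Summits.QuantumAdvantage.QuantumAdvantage.Theorems.PairLawA
import Summits.QuantumAdvantage.QuantumAdvantage.Theorems.DisperseArithmeticA

set_option linter.dupNamespace false
set_option linter.unusedSectionVars false

/-!
# PairLawB (lens 4, g29; (P7)(i)–(iii) of the (c0) road, EXPLICIT) — NON-DISPERSION MAKES A LEVEL SET DENSE

Blocker `X = AbsorptionDial.NoPerfectPolyOdd` (item 28487); decomp-qadv lens 4, g29.  Part K3a (`PairLawA`) proved
`nonDisperse_levelSet`: `E·p^K < #sparse · 4^|ι| · (|Ξ_h| + p^K·cos²(π/p)^(h+1))`.  This part turns it into the exact INPUT of Sanders'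
Bogolyubov–Ruzsa lemma [arXiv:1011.0107, Thm 20] — an explicit DENSITY lower bound for the symmetric level set `Ξ_h = levelSet c h`:

* `sparseSet_succ_subset`, ★ `card_sparseSet_le` (`#{v ∈ 𝔽_p^K : wt v < w₂} ≤ (K·p + 1)^w₂`, peeling one support entry at a time);
* `levelSet_dense` (if `2·(Kp+1)^w₂·4^|ι|·cos(π/p)^(2(h+1)) ≤ E` then `E·p^K ≤ 2·(Kp+1)^w₂·4^|ι|·|Ξ_h|`);
* ★★ `levelSet_dense_explicit` (the same from the polynomial-size conditions `2·(Kp+1)^w₂·4^|ι| ≤ E·p^L` and `2·p²·(L·p) ≤ h + 1`, via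
  `DisperseArithmetic.cos_pow_le` / `exp_neg_le`): density `α ≥ p^(−L)`, so Sanders gives a subspace `Y ⊆ 2Ξ_h − 2Ξ_h ⊆ Ξ_{4h}`
  (`add_mem_levelSet`, `neg_mem_levelSet`) of codimension `O_p(L⁴ log⁴ p)`, and `LevelRankA.rank_le_of_sparse_subspace` then bounds the rank.

Supports stmt-QuantumAdvantage-28487 (record; the residual `X` is NOT claimed).
-/

open Finset

namespace Summit.QuantumAdvantage.QuantumAdvantage.Theorems.PairLaw

variable {p : ℕ} [NeZero p] {ι : Type*} [Fintype ι] [DecidableEq ι] {K : ℕ}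

/-- peeling one support entry: a vector of weight `< w + 1` is either `0` or a weight-`< w` vector plus one coordinate multiple -/
theorem sparseSet_succ_subset (K w : ℕ) :
    sparseSet (p := p) K (w + 1) ⊆ insert 0
      (((univ : Finset (Fin K)) ×ˢ ((univ : Finset (ZMod p)) ×ˢ sparseSet (p := p) K w)).image
        (fun x => x.2.2 + Pi.single x.1 x.2.1)) := by
  classical
  intro v hv
  unfold sparseSet at hv ⊢
  rw [mem_filter] at hv
  rw [mem_insert, mem_image]
  by_cases h0 : (univ.filter fun j => v j ≠ 0).card = 0
  · left
    ext j
    by_contra hj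
    have : j ∈ (univ.filter fun j => v j ≠ 0) := mem_filter.mpr ⟨mem_univ _, hj⟩
    rw [card_eq_zero] at h0
    rw [h0] at this
    simp at this
  · right
    obtain ⟨j, hj⟩ := card_pos.mp (Nat.pos_of_ne_zero h0)
    have hjmem := hj
    rw [mem_filter] at hj
    refine ⟨(j, v j, Function.update v j 0), ?_, ?_⟩
    · rw [mem_product, mem_product, mem_filter]
      refine ⟨mem_univ _, mem_univ _, mem_univ _, ?_⟩
      have hsub : (univ.filter fun i => Function.update v j 0 i ≠ 0) = (univ.filter fun i => v i ≠ 0).erase j := by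
        ext i
        simp only [mem_filter, mem_univ, true_and, mem_erase]
        by_cases hij : i = j
        · subst hij; simp
        · rw [Function.update_of_ne hij]; exact ⟨fun h => ⟨hij, h⟩, fun h => h.2⟩
      rw [hsub, card_erase_of_mem hjmem]
      omega
    · ext i
      simp only [Pi.add_apply]
      by_cases hij : i = j
      · subst hij; simp
      · rw [Function.update_of_ne hij, Pi.single_eq_of_ne hij, add_zero]

/-- **`#{v ∈ 𝔽_p^K : wt v < w₂} ≤ (K·p + 1)^w₂`** -/
theorem card_sparseSet_le (K w₂ : ℕ) : (sparseSet (p := p) K w₂).card ≤ (K * p + 1) ^ w₂ := by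
  classical
  induction w₂ with
  | zero =>
    have : sparseSet (p := p) K 0 = ∅ := by
      unfold sparseSet
      ext v
      simp
    rw [this]
    simp
  | succ w ih =>
    have himg : (((univ : Finset (Fin K)) ×ˢ ((univ : Finset (ZMod p)) ×ˢ sparseSet (p := p) K w)).image
        (fun x => x.2.2 + Pi.single x.1 x.2.1)).card ≤ K * p * (sparseSet (p := p) K w).card := by
      refine card_image_le.trans (le_of_eq ?_)
      rw [card_product, card_product, card_univ, card_univ, Fintype.card_fin, ZMod.card, mul_assoc]
    have h1 : (sparseSet (p := p) K (w + 1)).card ≤ 1 + K * p * (sparseSet (p := p) K w).card :=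
      (card_le_card (sparseSet_succ_subset K w)).trans ((card_insert_le _ _).trans (by omega))
    have hq : 1 ≤ (K * p + 1) ^ w := Nat.one_le_pow _ _ (by omega)
    have h2 : K * p * (sparseSet (p := p) K w).card ≤ K * p * (K * p + 1) ^ w := Nat.mul_le_mul_left _ ih
    calc (sparseSet (p := p) K (w + 1)).card ≤ 1 + K * p * (K * p + 1) ^ w := by omega
      _ ≤ (K * p + 1) ^ w + K * p * (K * p + 1) ^ w := by omega
      _ = (K * p + 1) ^ (w + 1) := by ring

/-- density of the level set from non-dispersion, given that the spectral tail is at most half of `E` -/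
theorem levelSet_dense (hp2 : 2 ≤ p) (c : ι → Fin K → ZMod p) (w₂ E h : ℕ)
    (hfail : E < (univ.filter fun xx : (ι → Bool) × (ι → Bool) =>
      (univ.filter fun j => diffMap c xx j ≠ 0).card < w₂).card)
    (hh : 2 * ((K * p + 1) ^ w₂ : ℝ) * 4 ^ Fintype.card ι * (Real.cos (Real.pi / p) ^ 2) ^ (h + 1) ≤ E) :
    (E : ℝ) * (p : ℝ) ^ K ≤ 2 * ((K * p + 1) ^ w₂ : ℝ) * 4 ^ Fintype.card ι * (levelSet c h).card := by
  have h1 := nonDisperse_levelSet c hp2 w₂ E hfail h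
  have hS : ((sparseSet (p := p) K w₂).card : ℝ) ≤ ((K * p + 1) ^ w₂ : ℝ) := by
    exact_mod_cast card_sparseSet_le (p := p) K w₂
  have hpK : (0 : ℝ) ≤ (p : ℝ) ^ K := by positivity
  have hθ : 0 ≤ (Real.cos (Real.pi / p) ^ 2) ^ (h + 1) := by positivity
  have hL : (0 : ℝ) ≤ (levelSet c h).card := by positivity
  have h2 : (E : ℝ) * (p : ℝ) ^ K
      < ((K * p + 1) ^ w₂ : ℝ) * (4 ^ Fintype.card ι * ((levelSet c h).card + (p : ℝ) ^ K * (Real.cos (Real.pi / p) ^ 2) ^ (h + 1))) :=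
    h1.trans_le (mul_le_mul_of_nonneg_right hS (by positivity))
  have h3 : ((K * p + 1) ^ w₂ : ℝ) * (4 ^ Fintype.card ι * ((p : ℝ) ^ K * (Real.cos (Real.pi / p) ^ 2) ^ (h + 1)))
      ≤ (E : ℝ) * (p : ℝ) ^ K / 2 := by
    have := mul_le_mul_of_nonneg_right hh hpK
    nlinarith
  nlinarith

/-- **(P7)(i)–(iii), EXPLICIT.**  Under the polynomial-size conditions `2·(Kp+1)^w₂·4^|ι| ≤ E·p^L` and `2·p²·(L·p) ≤ h + 1`, non-dispersion
forces `|levelSet c h| ≥ α·p^K` with `α = E / (2·(Kp+1)^w₂·4^|ι|) ≥ p^(−L)`. -/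
theorem levelSet_dense_explicit (hp2 : 2 ≤ p) (c : ι → Fin K → ZMod p) (w₂ E h L : ℕ)
    (hfail : E < (univ.filter fun xx : (ι → Bool) × (ι → Bool) =>
      (univ.filter fun j => diffMap c xx j ≠ 0).card < w₂).card)
    (hEL : 2 * (K * p + 1) ^ w₂ * 4 ^ Fintype.card ι ≤ E * p ^ L) (hh : 2 * p ^ 2 * (L * p) ≤ h + 1) :
    (E : ℝ) * (p : ℝ) ^ K ≤ 2 * ((K * p + 1) ^ w₂ : ℝ) * 4 ^ Fintype.card ι * (levelSet c h).card := by
  refine levelSet_dense hp2 c w₂ E h hfail ?_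
  have hp2r : (2 : ℝ) ≤ p := by exact_mod_cast hp2
  have hp1r : (1 : ℝ) ≤ p := by linarith
  have hp0 : (0 : ℝ) < p := by linarith
  obtain ⟨_, hcos, _, hc0⟩ := DisperseArithmetic.cos_pi_div_le hp2r
  have hx0 : (0 : ℝ) ≤ 1 / p := by positivity
  have hx1 : 1 / (p : ℝ) ≤ 1 := by rw [div_le_one hp0]; exact hp1r
  -- cos(π/p)^(2(h+1)) ≤ cos(1/p)^(2(h+1)) ≤ exp(−2(h+1)/(4p²)) ≤ exp(−(0 + L·p)) ≤ 1/p^L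
  have hstep : (Real.cos (Real.pi / p) ^ 2) ^ (h + 1) ≤ 1 / (p : ℝ) ^ L := by
    have e1 : (Real.cos (Real.pi / p) ^ 2) ^ (h + 1) ≤ Real.cos (1 / p) ^ (2 * (h + 1)) := by
      rw [← pow_mul]
      exact pow_le_pow_left₀ hc0 hcos _
    have e2 := DisperseArithmetic.cos_pow_le hx0 hx1 (2 * (h + 1))
    have e3 : Real.exp (-(((2 * (h + 1) : ℕ) : ℝ) * (1 / (p : ℝ)) ^ 2 / 4)) ≤ Real.exp (-((0 : ℝ) + L * p)) := by
      have hcast : (((2 * p ^ 2 * (L * p) : ℕ) : ℝ)) ≤ ((h + 1 : ℕ) : ℝ) := by exact_mod_cast hh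
      push_cast at hcast
      have hp2sq : (0 : ℝ) < 2 * (p : ℝ) ^ 2 := by positivity
      have key : (((2 * (h + 1) : ℕ) : ℝ)) * (1 / (p : ℝ)) ^ 2 / 4 = ((h : ℝ) + 1) / (2 * (p : ℝ) ^ 2) := by
        push_cast
        field_simp
        ring
      rw [Real.exp_le_exp, key, zero_add, neg_le_neg_iff, le_div_iff₀ hp2sq]
      nlinarith [hcast]
    have e4 := DisperseArithmetic.exp_neg_le 0 L hp1r
    rw [neg_zero, Real.exp_zero] at e4
    exact e1.trans (e2.trans (e3.trans e4))
  have hELr : 2 * ((K * p + 1) ^ w₂ : ℝ) * 4 ^ Fintype.card ι ≤ (E : ℝ) * (p : ℝ) ^ L := by exact_mod_cast hEL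
  have hpL : (0 : ℝ) < (p : ℝ) ^ L := by positivity
  calc 2 * ((K * p + 1) ^ w₂ : ℝ) * 4 ^ Fintype.card ι * (Real.cos (Real.pi / p) ^ 2) ^ (h + 1)
      ≤ 2 * ((K * p + 1) ^ w₂ : ℝ) * 4 ^ Fintype.card ι * (1 / (p : ℝ) ^ L) :=
        mul_le_mul_of_nonneg_left hstep (by positivity)
    _ ≤ (E : ℝ) * (p : ℝ) ^ L * (1 / (p : ℝ) ^ L) := mul_le_mul_of_nonneg_right hELr (by positivity)
    _ = E := by field_simp

end Summit.QuantumAdvantage.QuantumAdvantage.Theorems.PairLaw
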